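import Mathlib
import Summits.ValiantsHypothesis.ValiantsHypothesis.Theorems.LacunarySymmetroidMatrixDescartesTieLawBoundary
import HarnessLib

/-!
# ValiantsHypothesis / LacunarySymmetroid — crux `MatrixDescartes` (stmt-ValiantsHypothesis-18050, V1), LINE (A) «product_plus_one»:
# the TIE LAW, kernel path Stage 2, part 4b — the boundary lemma (45.2): the ray identity, `Im D < 0`, `M_F ≠ 0` on the rays

`map_MF_eval`, `eval_map_conj`, `gPoly_root_unique` (the positive root of `g` is unique), `MF_ray_identity` (off the `σ_f`:
`K x₀^a M_F(x₀) = Π_F · D_F`), `im_boundarySum_neg` (`Im D_F < 0`, from (I3)), and **the boundary lemma** `MF_eval_upper_ray_ne_zero` /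
`MF_eval_lower_ray_ne_zero` (pen val-idea-25 g8, HOME NOTE §45.2): with pairwise distinct positive roots `σ_f`, `M_F(t e^{±iπ/c}) ≠ 0`
for all `t > 0`.  HONEST FRAMING: helper lemmas; no stub of LINE (A) is touched; `MatrixDescartes` OPEN; `VP ≠ VNP` is NOT proved.
No definitions, no named facts.
-/

set_option linter.dupNamespace false

namespace Summit.ValiantsHypothesis.ValiantsHypothesis.Theorems.LacunarySymmetroidMatrixDescartes

namespace TieLaw

open Polynomial Filter Topology

section Boundary

variable {a b c : ℕ} {β γ : ℝ}

/-! ### `M_F` over `ℂ`, on the ray -/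

/-- Evaluation of `M_F` over `ℂ`. -/
theorem map_MF_eval {ι : Type*} [DecidableEq ι] (a b : ℕ) (F : Finset ι) (β γ w : ι → ℝ) (z : ℂ) :
    ((MF a b F β γ w).map (algebraMap ℝ ℂ)).eval z =
      ∑ f ∈ F, (w f : ℂ) * ((nPoly a b (a + b) (β f) (γ f)).map (algebraMap ℝ ℂ)).eval z *
        ∏ f' ∈ F.erase f, ((qPoly a (a + b) (β f') (γ f')).map (algebraMap ℝ ℂ)).eval z := by
  simp only [MF, Polynomial.map_sum, Polynomial.map_mul, Polynomial.map_prod, map_C, eval_finsetSum, eval_mul,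
    eval_prod, eval_C, Complex.coe_algebraMap]

/-- A real polynomial evaluated at a conjugate (private: the same fact exists under other names in unrelated Literature
modules, e.g. `Literature.Combinatorics.StablePolynomials.conj_eval_map_polynomial`). -/
private theorem eval_map_conj (p : ℝ[X]) (z : ℂ) :
    (p.map (algebraMap ℝ ℂ)).eval ((starRingEnd ℂ) z) = (starRingEnd ℂ) ((p.map (algebraMap ℝ ℂ)).eval z) := by
  rw [eval_map, eval_map, hom_eval₂]
  congr 1
  ext x
  simp

/-- Uniqueness of the positive root of `g` (`γ > 0`): `g` is strictly increasing on `(0, ∞)`. -/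
theorem gPoly_root_unique (hγ : 0 < γ) {s t : ℝ} (hs : 0 < s) (ht : 0 < t)
    (hs0 : (gPoly a c β γ).eval s = 0) (ht0 : (gPoly a c β γ).eval t = 0) (ha : 0 < a) : s = t := by
  have hev : ∀ u : ℝ, (gPoly a c β γ).eval u = γ * u ^ c + u ^ a - β := fun u => by
    simp [gPoly, eval_add, eval_sub, eval_mul, eval_pow, eval_C, eval_X]
  rw [hev] at hs0 ht0
  by_contra hne
  rcases lt_or_gt_of_ne hne with h | h
  · have h1 : s ^ a < t ^ a := pow_lt_pow_left₀ h hs.le ha.ne'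
    have h2 : s ^ c ≤ t ^ c := pow_le_pow_left₀ hs.le h.le c
    nlinarith
  · have h1 : t ^ a < s ^ a := pow_lt_pow_left₀ h ht.le ha.ne'
    have h2 : t ^ c ≤ s ^ c := pow_le_pow_left₀ ht.le h.le c
    nlinarith

/-- **The boundary identity off the `σ_f`** (pen §45.2 (α)): if `g_f(t) ≠ 0` for all wells then
`K (tω)^a M_F(tω) = (∏_f g_f(tε) g_f(t)) · Σ_f w_f (U_f / g_f(tε) − V_f / g_f(t))`. -/
theorem MF_ray_identity {ι : Type*} [DecidableEq ι] (hab : a < b) (F : Finset ι) (β γ w : ι → ℝ) (t : ℝ)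
    (hR : ∀ f ∈ F, (gPoly a (a + b) (β f) (γ f)).eval t ≠ 0) (ha : 0 < a) (ht : 0 < t) :
    (rot (Real.pi / (a + b : ℕ)) ^ a - rot (-(Real.pi / (a + b : ℕ))) ^ a) * ((t : ℂ) * rot (Real.pi / (a + b : ℕ))) ^ a *
        ((MF a b F β γ w).map (algebraMap ℝ ℂ)).eval ((t : ℂ) * rot (Real.pi / (a + b : ℕ))) =
      (∏ f ∈ F, ((gPoly a (a + b) (β f) (γ f)).map (algebraMap ℝ ℂ)).eval ((t : ℂ) * rot (2 * Real.pi / (a + b : ℕ))) *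
          ((((gPoly a (a + b) (β f) (γ f)).eval t : ℝ)) : ℂ)) *
        ∑ f ∈ F, (w f : ℂ) *
          ((((a + b : ℕ) : ℂ) * γ f * ((t : ℂ) * rot (2 * Real.pi / (a + b : ℕ))) ^ (a + b) +
              a * ((t : ℂ) * rot (2 * Real.pi / (a + b : ℕ))) ^ a) /
              ((gPoly a (a + b) (β f) (γ f)).map (algebraMap ℝ ℂ)).eval ((t : ℂ) * rot (2 * Real.pi / (a + b : ℕ))) -
            ((((a + b : ℕ) * γ f * t ^ (a + b) + a * t ^ a : ℝ)) : ℂ) / ((((gPoly a (a + b) (β f) (γ f)).eval t : ℝ)) : ℂ)) := by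
  set c := a + b with hc
  have hc0 : c ≠ 0 := by omega
  have h2a : 2 * a < c := by omega
  set ω := rot (Real.pi / c)
  set ε := rot (2 * Real.pi / c)
  set x₀ := (t : ℂ) * ω with hx₀
  set K := ω ^ a - rot (-(Real.pi / c)) ^ a
  -- per-well data
  set G : ι → ℂ := fun f => ((gPoly a c (β f) (γ f)).map (algebraMap ℝ ℂ)).eval ((t : ℂ) * ε) with hG
  set R : ι → ℂ := fun f => ((((gPoly a c (β f) (γ f)).eval t : ℝ)) : ℂ) with hRdef
  set U : ι → ℂ := fun f => (c : ℂ) * γ f * ((t : ℂ) * ε) ^ c + a * ((t : ℂ) * ε) ^ a with hU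
  set V : ι → ℂ := fun f => ((((c : ℕ) * γ f * t ^ c + a * t ^ a : ℝ)) : ℂ) with hV
  have hG0 : ∀ f ∈ F, G f ≠ 0 := fun f _ => map_gPoly_eval_ray_ne_zero ha h2a (β f) (γ f) ht
  have hR0 : ∀ f ∈ F, R f ≠ 0 := fun f hf => by
    simp only [hRdef]
    exact_mod_cast hR f hf
  have hq : ∀ f, ((qPoly a c (β f) (γ f)).map (algebraMap ℝ ℂ)).eval x₀ = G f * R f := fun f =>
    map_qPoly_eval_ray hc0 a (β f) (γ f) t
  have hn : ∀ f, K * x₀ ^ a * ((nPoly a b c (β f) (γ f)).map (algebraMap ℝ ℂ)).eval x₀ = U f * R f - V f * G f :=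
    fun f => ray_I2 hc ha (β f) (γ f) t
  rw [map_MF_eval, Finset.mul_sum, Finset.mul_sum]
  refine Finset.sum_congr rfl fun f hf => ?_
  have hprod : ∏ f' ∈ F.erase f, ((qPoly a (a + b) (β f') (γ f')).map (algebraMap ℝ ℂ)).eval x₀ =
      ∏ f' ∈ F.erase f, (G f' * R f') := Finset.prod_congr rfl fun f' _ => hq f'
  rw [hprod, ← Finset.mul_prod_erase F (fun f' => G f' * R f') hf]
  have hGf := hG0 f hf
  have hRf := hR0 f hf
  calc K * x₀ ^ a * ((w f : ℂ) * ((nPoly a b (a + b) (β f) (γ f)).map (algebraMap ℝ ℂ)).eval x₀ *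
          ∏ f' ∈ F.erase f, (G f' * R f'))
        = (w f : ℂ) * (K * x₀ ^ a * ((nPoly a b c (β f) (γ f)).map (algebraMap ℝ ℂ)).eval x₀) *
            ∏ f' ∈ F.erase f, (G f' * R f') := by ring
    _ = (w f : ℂ) * (U f * R f - V f * G f) * ∏ f' ∈ F.erase f, (G f' * R f') := by rw [hn f]
    _ = G f * R f * (∏ f' ∈ F.erase f, (G f' * R f')) * ((w f : ℂ) * (U f / G f - V f / R f)) := by
          rw [div_sub_div _ _ hGf hRf]
          field_simp

/-- **`Im D < 0`**: the weighted sum of the wells' ray quotients has negative imaginary part (pen §45.2 (α), (I3)). -/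
theorem im_boundarySum_neg {ι : Type*} (hab : a < b) (F : Finset ι) (hF : F.Nonempty) (β γ w : ι → ℝ)
    (hβ : ∀ f ∈ F, 0 < β f) (hγ : ∀ f ∈ F, 0 < γ f) (hw : ∀ f ∈ F, 0 < w f) (ha : 0 < a) {t : ℝ} (ht : 0 < t) :
    (∑ f ∈ F, (w f : ℂ) *
        ((((a + b : ℕ) : ℂ) * γ f * ((t : ℂ) * rot (2 * Real.pi / (a + b : ℕ))) ^ (a + b) +
              a * ((t : ℂ) * rot (2 * Real.pi / (a + b : ℕ))) ^ a) /
              ((gPoly a (a + b) (β f) (γ f)).map (algebraMap ℝ ℂ)).eval ((t : ℂ) * rot (2 * Real.pi / (a + b : ℕ))) -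
          ((((a + b : ℕ) * γ f * t ^ (a + b) + a * t ^ a : ℝ)) : ℂ) /
            ((((gPoly a (a + b) (β f) (γ f)).eval t : ℝ)) : ℂ))).im < 0 := by
  rw [Complex.im_sum]
  apply Finset.sum_neg (fun f hf => ?_) hF
  rw [Complex.im_ofReal_mul, Complex.sub_im, ← Complex.ofReal_div, Complex.ofReal_im, sub_zero]
  exact mul_neg_of_pos_of_neg (hw f hf) (ray_im_div_neg rfl ha hab (hβ f hf) (hγ f hf) ht)

/-- **Boundary lemma (45.2), upper ray.**  For a nonempty finite set of wells with positive data whose positive roots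
`σ_f` (`g_f(σ_f) = 0`) are pairwise distinct, `M_F(t e^{iπ/c}) ≠ 0` for every `t > 0`. -/
theorem MF_eval_upper_ray_ne_zero {ι : Type*} [DecidableEq ι] (ha : 0 < a) (hab : a < b) (F : Finset ι)
    (hF : F.Nonempty) (β γ w σ : ι → ℝ) (hβ : ∀ f ∈ F, 0 < β f) (hγ : ∀ f ∈ F, 0 < γ f) (hw : ∀ f ∈ F, 0 < w f)
    (hσ : ∀ f ∈ F, 0 < σ f) (hroot : ∀ f ∈ F, (gPoly a (a + b) (β f) (γ f)).eval (σ f) = 0)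
    (hinj : Set.InjOn σ F) {t : ℝ} (ht : 0 < t) :
    ((MF a b F β γ w).map (algebraMap ℝ ℂ)).eval ((t : ℂ) * rot (Real.pi / (a + b : ℕ))) ≠ 0 := by
  set c := a + b with hc
  have hc0 : c ≠ 0 := by omega
  have h2a : 2 * a < c := by omega
  have hac : a < c := by omega
  set ω := rot (Real.pi / c)
  set ε := rot (2 * Real.pi / c)
  set x₀ := (t : ℂ) * ω with hx₀
  have hK : ω ^ a - rot (-(Real.pi / c)) ^ a ≠ 0 := rot_pow_sub_rot_neg_pow_ne_zero ha hac
  have hx₀0 : x₀ ≠ 0 := mul_ne_zero (by exact_mod_cast ht.ne') (rot_ne_zero _)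
  have hG0 : ∀ f ∈ F, ((gPoly a c (β f) (γ f)).map (algebraMap ℝ ℂ)).eval ((t : ℂ) * ε) ≠ 0 :=
    fun f _ => map_gPoly_eval_ray_ne_zero ha h2a (β f) (γ f) ht
  by_cases hcase : ∃ f₀ ∈ F, (gPoly a c (β f₀) (γ f₀)).eval t = 0
  · -- case (β): t = σ_{f₀}; only the f₀ summand survives
    obtain ⟨f₀, hf₀, ht0⟩ := hcase
    have hothers : ∀ f ∈ F, f ≠ f₀ → (gPoly a c (β f) (γ f)).eval t ≠ 0 := by
      intro f hf hne h0
      have e1 : t = σ f := gPoly_root_unique (hγ f hf) ht (hσ f hf) h0 (hroot f hf) ha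
      have e2 : t = σ f₀ := gPoly_root_unique (hγ f₀ hf₀) ht (hσ f₀ hf₀) ht0 (hroot f₀ hf₀) ha
      exact hne (hinj hf hf₀ (e1.symm.trans e2))
    have hq0 : ((qPoly a c (β f₀) (γ f₀)).map (algebraMap ℝ ℂ)).eval x₀ = 0 := by
      rw [map_qPoly_eval_ray hc0, ht0]
      simp
    rw [map_MF_eval, Finset.sum_eq_single f₀]
    · -- the surviving term is non-zero
      have hn : ((nPoly a b c (β f₀) (γ f₀)).map (algebraMap ℝ ℂ)).eval x₀ ≠ 0 := by
        intro h0
        have h := ray_I2 hc ha (β f₀) (γ f₀) t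
        rw [h0, mul_zero, ht0] at h
        simp only [Complex.ofReal_zero, mul_zero, zero_sub] at h
        have hV : (0 : ℝ) < c * γ f₀ * t ^ c + a * t ^ a := by
          have : (0 : ℝ) < c := by exact_mod_cast Nat.pos_of_ne_zero hc0
          have := hγ f₀ hf₀
          positivity
        have hV' : (((c * γ f₀ * t ^ c + a * t ^ a : ℝ)) : ℂ) ≠ 0 := by exact_mod_cast hV.ne'
        exact (mul_ne_zero hV' (hG0 f₀ hf₀)) (neg_eq_zero.1 h.symm)
      refine mul_ne_zero (mul_ne_zero (by exact_mod_cast (hw f₀ hf₀).ne') hn) ?_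
      refine Finset.prod_ne_zero_iff.2 fun f' hf' => ?_
      obtain ⟨hne, hf'F⟩ := Finset.mem_erase.1 hf'
      rw [map_qPoly_eval_ray hc0]
      exact mul_ne_zero (hG0 f' hf'F) (by exact_mod_cast hothers f' hf'F hne)
    · intro f hf hne
      apply mul_eq_zero_of_right
      exact Finset.prod_eq_zero (Finset.mem_erase.2 ⟨Ne.symm hne, hf₀⟩) hq0
    · intro h; exact absurd hf₀ h
  · -- case (α): the identity and `Im D < 0`
    push Not at hcase
    have hid := MF_ray_identity hab F β γ w t hcase ha ht
    intro h0
    rw [h0, mul_zero] at hid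
    have hPi : (∏ f ∈ F, ((gPoly a c (β f) (γ f)).map (algebraMap ℝ ℂ)).eval ((t : ℂ) * ε) *
        ((((gPoly a c (β f) (γ f)).eval t : ℝ)) : ℂ)) ≠ 0 :=
      Finset.prod_ne_zero_iff.2 fun f hf => mul_ne_zero (hG0 f hf) (by exact_mod_cast hcase f hf)
    have hD := (mul_eq_zero.1 hid.symm).resolve_left hPi
    have him := im_boundarySum_neg hab F hF β γ w hβ hγ hw ha ht
    rw [hD, Complex.zero_im] at him
    exact lt_irrefl _ him

/-- **Boundary lemma (45.2), both rays**: also `M_F(t e^{−iπ/c}) ≠ 0`, by conjugation (`M_F` is real). -/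
theorem MF_eval_lower_ray_ne_zero {ι : Type*} [DecidableEq ι] (ha : 0 < a) (hab : a < b) (F : Finset ι)
    (hF : F.Nonempty) (β γ w σ : ι → ℝ) (hβ : ∀ f ∈ F, 0 < β f) (hγ : ∀ f ∈ F, 0 < γ f) (hw : ∀ f ∈ F, 0 < w f)
    (hσ : ∀ f ∈ F, 0 < σ f) (hroot : ∀ f ∈ F, (gPoly a (a + b) (β f) (γ f)).eval (σ f) = 0)
    (hinj : Set.InjOn σ F) {t : ℝ} (ht : 0 < t) :
    ((MF a b F β γ w).map (algebraMap ℝ ℂ)).eval ((t : ℂ) * rot (-(Real.pi / (a + b : ℕ)))) ≠ 0 := by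
  have hconj : (t : ℂ) * rot (-(Real.pi / (a + b : ℕ))) = (starRingEnd ℂ) ((t : ℂ) * rot (Real.pi / (a + b : ℕ))) := by
    rw [map_mul, Complex.conj_ofReal, conj_rot]
  rw [hconj, eval_map_conj, map_ne_zero_iff _ (RingHom.injective _)]
  exact MF_eval_upper_ray_ne_zero ha hab F hF β γ w σ hβ hγ hw hσ hroot hinj ht

end Boundary

end TieLaw

end Summit.ValiantsHypothesis.ValiantsHypothesis.Theorems.LacunarySymmetroidMatrixDescartes
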